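/-
Copyright (c) 2026 the pub-hodgecm-mathlib formalisation cell (harness21).  Prover seat hodgecm-mathlib-LH7-p08 (g2) (Track A hand on the K2-lead VALVE),
#184♮ = hLiu418 = `stmt-HodgeConjecture-24832`; #42F′ FACE-G organ plan (RULING M-158q (a)), file F2 «(G-eq-b) the SECTION-LEVEL PRODUCER `Xφ` for the generator
`φ_x = detChar(α) · swSectionTensor sB x`» (LEAD F0P6-plan (g14) BATCH #106 (2); desk K2Liu-p10 (g6), census `CENSUS-FACE-G-Rgen` §2 (β), §3 (G-eq-b), §5 F2).
-/
import Summits.HodgeConjecture.HodgeConjecture.Theorems.K2LiuArchPlaceSecExp                        -- ★ (G2-W4-iii): `exists_archSkew_archExp_eq_placeSecJ_expMem`, ★ W4 `contDiffAt_coe_expMem_smul`, ★ `contDiffAt_character_inl`, `archExp`, `placeSecJ`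
import Literature.NumberTheory.GelbartRogawski1991.DoubledWeilRepresentationDetTwist                -- ★ `DoubledWeilDetTwist.detChar`, `continuous_coe_detChar`
import HarnessLib

/-!
# Crux `HLiu418`, #42F′ FACE-G, file F2 (G-eq-b) — `K2LiuSwSectionTensorArchOrbitDeriv`: THE ORBIT DERIVATIVE OF A CHARACTER-TWISTED SECTION
# `∂_t|₀ [θ(h·γ_X(t)) · φ(h·γ_X(t))] = θ(h) · (c_X · φ(h) + Xφ(h))` — G1-END's letter `hXφ` for `φ_x = detChar(α) · swSectionTensor sB x`

Cell `hodgecm-mathlib`, crux item hLiu418 = `stmt-HodgeConjecture-24832`, route of record `HCCMUnconditional`; squad K2 ∕ K2Liu, socket #42F′, FACE-G organ plan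
of record (LEAD F0P6-plan (g14) RULING M-158q (a), desk K2Liu-p10 (g6) `CENSUS-FACE-G-Rgen`): F1 `faceG_of_organs : ‹#41› → ‹G-eq› → ‹G-Θ› → ‹G-gen› → ‹FACE-G HL›`
runs the span induction (ε) «`Res(Xψ) = ∂_X Res(ψ)`» over ★ G1-END `K2LiuResidueLieDerivativeStandard.hasDerivAt_resGen_stdExtension_orbit_half`, whose section-level
input is the letter **`hXφ : ∀ h, HasDerivAt (fun t => φ (h * archExp … hX t)) (Xφ h) 0`** for the section `φ` of the family at `s₀ = ½`.  For #42F′'s generator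
(★ `K2LiuFirstTermIdentityAssemblyDatumPrime`) the family is `s h ↦ detChar α h · stdExt 𝒦 ½ (swSectionTensor sB x) s h = stdExt 𝒦 ½ (φ_x) s h` with
**`φ_x h := detChar α h · swSectionTensor sB x h`** (`mul_left_comm` on ★ `stdExtension`'s body), a CHARACTER-TWISTED Siegel–Weil section.  THEOREMS ONLY (no `def`,
no `instance`, no `notation`, no named-fact hypothesis, no `sorry`); the Mathlib idiom `attribute [local instance 100] LieRing.ofAssociativeRing` names `𝔲(2,2)` as in ★
(G2-W2)∕(G2-W4); lane `--supports stmt-HodgeConjecture-24832 --as helper` (count-neutral helper; closes no socket by itself).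

THE MATHEMATICS [KudlaRallis1994, §1], [Varadarajan1984, Thm. 2.10.1, 2.11.2], [BorelJacquet1979, §4.1], [GelbartRogawski1991, §3.1 Remark p. 457].  Let `θ : H(𝔸) →* ℂˣ`
be a continuous character (read `θ = detChar α = α ∘ det`, ★ `DoubledWeilDetTwist.detChar`, `continuous_coe_detChar`), `X ∈ 𝔲 = archSkew` with orbit `γ_X(t) = archExp hX t`,
and `φ` a section with right Lie derivative `Xφ` along `γ_X` (`hXφ`, BY VALUE — for the SW sections of `𝔻 ⊗ V′` on polynomial × Gaussian data it is ★ (r-b)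
`K2LiuArchSWValueFockDerivative.exists_fockPoly_hasDerivAt_swSectionTensor_oneplace` ∕ ★ D2 `derivClause_archSWValue_hermite` read through the curve identity ★
`K2LiuArchPlaceSecExp`; for `swSection` it is ★ `exists_archSkew_hasDerivAt_swSection_tmul_archExp`).  Since `θ(h·γ_X(t)) = θ(h)·θ(γ_X(t))` and `t ↦ θ(γ_X(t))` is a
continuous one-parameter character, it is `C^∞` (É. Cartan) with some derivative `c_X = θ′_X(0)` at `t = 0`, and the product rule gives
**`∂_t|₀ [θ(h·γ_X t)·φ(h·γ_X t)] = θ(h)·(c_X·φ(h) + Xφ(h))`** — G1-END's `hXφ` for the twisted section `θ·φ` with `X(θ·φ) = θ·(c_X·φ + Xφ)`, again a twisted section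
of the SAME kind (for SW data: `c_X • x + x_Y`, polynomial × Gaussian at `σ` with the same off-`σ` factor — ★ `binvPi` is linear — so the span induction (ε) stays inside
★ D2's Fock system and K-finiteness of `𝔲·V` is free).
* §1 **`hasDerivAt_coe_mul_archExp_of_hasDerivAt`** — the PRODUCT RULE above for any `θ : H(𝔸) →* ℂˣ`, BY VALUE in `hθ : HasDerivAt (t ↦ θ(γ_X t)) c 0` and `hXφ`
  (generic frame `(e, dV, dW)`, generic `X ∈ archSkew`; ★ `archExp_zero`, `map_mul`); `Xφ`-continuity companion `continuous_coe_mul_of_continuous` (G1-END's `hXφc`).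
* §2 **`hasDerivAt_coe_character_archExp`** — THE CHARACTER LEG: for `θ` continuous and the letter `X` of a one-place curve, `archExp hX s = archEmb (placeSecJ σ (exp (sY), 1))`
  (`hcurve`, BY VALUE = the output of ★ `exists_archSkew_archExp_eq_placeSecJ_expMem`, obtained ONCE per `(σ, Y)` by the assembler and shared with the SW leg),
  `t ↦ θ(archExp hX t)` is `C^∞` (`contDiffAt_coe_character_archExp`: ★ `K2LiuWeilDatumSmoothU22.contDiffAt_character_inl` at the continuous character
  `θ ∘ archEmb ∘ placeSecJ σ` of the junction group, ★ `continuous_archEmb`, ★ `continuous_placeSecJ`, along ★ W4 `contDiffAt_coe_expMem_smul`) and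
  `HasDerivAt (t ↦ θ(archExp hX t)) (deriv (t ↦ θ(archExp hX t)) 0) 0`; CM twin `hasDerivAt_coe_detChar_archExp` at `θ := detChar α` (`hα : Continuous α`).
* §3 **`hasDerivAt_detChar_mul_archExp`** — THE PRODUCER FOR #42F′'s GENERATOR: §2 ∘ §1 at `θ := detChar α`:
  `∀ h, HasDerivAt (t ↦ detChar α (h·γ_X t) · φ(h·γ_X t)) (detChar α h · (c_X · φ h + Xφ h)) 0`, `c_X := deriv (t ↦ detChar α (γ_X t)) 0`, with `hXφ` BY VALUE —
  instantiate `φ := swSectionTensor sB (E(a ⊗ f))`, `Xφ := swSectionTensor sB (E(a_Y ⊗ f))` (★ (r-b)) and read `c_X • E(a⊗f) + E(a_Y⊗f) = E((c_X•a + a_Y)⊗f)`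
  (★ `swSectionTensor_add`∕`_smul`) to get `X φ_x = φ_{x′}`, `x′ = E((c_X • a + a_Y) ⊗ f)`.
NOT HERE: the SW leg itself (★ (r-b) ∕ ★ D2, S2 organ) and its `archEmb (ψ (exp sY)) = archExp hX s` reading for `ψ_σ = placeSec_𝔻 σ ∘ relabel` (★ `K2LiuArchPlaceSecExp` §2 +
★ `placeSecJ_inl`; assembler's join); the closed form of `c_X`; F1 (ε) itself (K2Liu-p10); (G-Θ) F3; (G-gen) F4.
HONEST LABEL.  Count-neutral helper; it retires nothing by itself: `HC_CM` is proved only modulo the 7 printed citations (2 remaining named inputs: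
hLiu418 = `stmt-HodgeConjecture-24832`, h413 = `stmt-HodgeConjecture-24833`) until rung 0 closes.

## References
* [KudlaRallis1994] S. Kudla, S. Rallis, *A regularized Siegel–Weil formula: the first term identity*, Ann. of Math. 140 (1994): §1 (Lie derivatives of Siegel–Weil sections).
* [Varadarajan1984] V. S. Varadarajan, *Lie Groups, Lie Algebras, and Their Representations* (1984): Thm. 2.10.1 (one-parameter subgroups), Thm. 2.11.2 (continuous
  homomorphisms of Lie groups are analytic — É. Cartan).
* [BorelJacquet1979] A. Borel, H. Jacquet, Proc. Symp. Pure Math. 33.1 (1979): §4.1 (the archimedean component `G_∞ → G(𝔸)`).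
* [GelbartRogawski1991] S. Gelbart, J. Rogawski, Invent. Math. 105 (1991): §3.1 Remark p. 457 (the determinant twist `α ∘ det`).
-/

set_option autoImplicit false
-- the mandated namespace repeats the single-problem summit's segment (`HodgeConjecture.HodgeConjecture`)
set_option linter.dupNamespace false

noncomputable section

open scoped Classical Matrix TensorProduct SchwartzMap MatrixGroups Matrix.Norms.Operator Topology
open NumberField NumberField.InfinitePlace NumberField.mixedEmbedding IsDedekindDomain NormedSpace
open Literature.Analysis.SegalBargmann Literature.Analysis.Distribution
open Literature.RepresentationTheory.HeisenbergGroup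
open Literature.NumberTheory.Automorphic Literature.NumberTheory.Automorphic.UnitaryGroup
open Literature.NumberTheory.Weil1964 Literature.NumberTheory.Weil1964.MpS Literature.NumberTheory.Weil1964.UnitaryWeil
open Literature.RepresentationTheory.HarrisKudlaSweet1996 Literature.NumberTheory.GaloisRepresentations
open Literature.NumberTheory.GelbartRogawski1991 Literature.NumberTheory.GelbartRogawski1991.UnitaryDualPair
open Literature.NumberTheory.GelbartRogawski1991.UnitaryDualPair.LocalSplitting
open Literature.NumberTheory.GelbartRogawski1991.GRConstruction
open Literature.NumberTheory.K2Lit.SiegelDoubled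
open Literature.RepresentationTheory.KonnoKonno2007 hiding LetterKind letterOf letterGen letterOf_boost letterOf_torus letterOf_torus_eq
  letterGen_boost letterGen_torus letterGen_mem_lie exp_smul_letterGen
open Literature.RepresentationTheory.KonnoKonno2007.RealDualPair
open Summit.HodgeConjecture.HodgeConjecture.Cruxes.HLiu418.K2LiuArchSectionPlaceBlock
open Summit.HodgeConjecture.HodgeConjecture.Cruxes.HLiu418.K2LiuSwSectionArchOrbit (contDiffAt_coe_expMem_smul exists_archSkew_archExp_eq_placeSecJ_expMem)
open Summit.HodgeConjecture.HodgeConjecture.Cruxes.HLiu418 (K2LiuArchOneParameterOrbitDefs.archEmb K2LiuArchOneParameterOrbitDefs.archExp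
  K2LiuArchOneParameterOrbitDefs.archExp_zero K2LiuArchOneParameterOrbitDefs.continuous_archEmb)

-- Mathlib idiom (`Mathlib/Algebra/Lie/OfAssociative.lean`), as in ★ `RealMatrixGroups` ∕ (G2-W2) ∕ (G2-W4): the commutator bracket on `Matrix n n ℂ`, needed to name the
-- Lie algebra `(uFormGroup (Fin 2) (Fin 2)).lie` of `U(2,2)`
attribute [local instance 100] LieRing.ofAssociativeRing

namespace Summit.HodgeConjecture.HodgeConjecture.Cruxes.HLiu418.K2LiuSwSectionTensorArchOrbitDeriv

variable (L : Type) [Field L] [NumberField L] [IsCMField L]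
variable {N M n : ℕ} (e : Fin N × Fin M ≃ Fin n)
  (dV : Fin N → L) (hdV : ∀ i, IsCMField.complexConj L (dV i) = dV i) (hdV0 : ∀ i, dV i ≠ 0)
  (dW : Fin M → L) (hdW : ∀ i, IsCMField.complexConj L (dW i) = dW i) (hdW0 : ∀ i, dW i ≠ 0)

/-! ## §1 The product rule along an archimedean one-parameter orbit (generic `X ∈ 𝔲`, letters by value) -/

section ProductRule

variable {X : Matrix (Fin (n + n)) (Fin (n + n)) (mixedSpace L)}
  (hX : X ∈ archSkew (Fp L) L (IsCMField.complexConj L) (n + n) (hermD L e dV hdV dW hdW))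

/-- **THE PRODUCT RULE FOR A CHARACTER-TWISTED SECTION ALONG `γ_X`.**  For a character `θ : H(𝔸) →* ℂˣ` whose one-parameter restriction `t ↦ θ(γ_X t)` has derivative
`c` at `0` (`hθ`, §2 for continuous `θ`), and a section `φ` with right Lie derivative `Xφ` along `γ_X` (`hXφ`, G1-END's letter BY VALUE):
`HasDerivAt (t ↦ θ(h·γ_X t) · φ(h·γ_X t)) (θ(h) · (c · φ(h) + Xφ(h))) 0` for every `h ∈ H(𝔸)` — `θ(h·γ_X t) = θ(h)·θ(γ_X t)` (`map_mul`), `γ_X 0 = 1` (★ `archExp_zero`), product rule.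
[cite: KudlaRallis1994, §1] [cite: Varadarajan1984, Thm. 2.10.1] -/
theorem hasDerivAt_coe_mul_archExp_of_hasDerivAt (θ : HA L e dV hdV dW hdW →* ℂˣ) {c : ℂ}
    (hθ : HasDerivAt (fun t : ℝ => ((θ (K2LiuArchOneParameterOrbitDefs.archExp (Fp L) L (IsCMField.complexConj L) (n + n) (hermD L e dV hdV dW hdW) hX t) : ℂˣ) : ℂ))
      c 0)
    {φ Xφ : HA L e dV hdV dW hdW → ℂ}
    (hXφ : ∀ h : HA L e dV hdV dW hdW,
      HasDerivAt (fun t : ℝ => φ (h * K2LiuArchOneParameterOrbitDefs.archExp (Fp L) L (IsCMField.complexConj L) (n + n) (hermD L e dV hdV dW hdW) hX t)) (Xφ h) 0)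
    (h : HA L e dV hdV dW hdW) :
    HasDerivAt (fun t : ℝ =>
        ((θ (h * K2LiuArchOneParameterOrbitDefs.archExp (Fp L) L (IsCMField.complexConj L) (n + n) (hermD L e dV hdV dW hdW) hX t) : ℂˣ) : ℂ) *
          φ (h * K2LiuArchOneParameterOrbitDefs.archExp (Fp L) L (IsCMField.complexConj L) (n + n) (hermD L e dV hdV dW hdW) hX t))
      (((θ h : ℂˣ) : ℂ) * (c * φ h + Xφ h)) 0 := by
  -- the character leg through `h`: `θ(h·γ t) = θ h · θ(γ t)`
  have hθh : HasDerivAt (fun t : ℝ =>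
      ((θ (h * K2LiuArchOneParameterOrbitDefs.archExp (Fp L) L (IsCMField.complexConj L) (n + n) (hermD L e dV hdV dW hdW) hX t) : ℂˣ) : ℂ))
      (((θ h : ℂˣ) : ℂ) * c) 0 := by
    have h1 := hθ.const_mul ((θ h : ℂˣ) : ℂ)
    refine h1.congr_of_eventuallyEq (Filter.Eventually.of_forall fun t => ?_)
    simp only [map_mul, Units.val_mul]
  have hprod := hθh.mul (hXφ h)
  simp only [K2LiuArchOneParameterOrbitDefs.archExp_zero, mul_one] at hprod
  exact hprod.congr_deriv (by ring)

/-- **continuity of the derived twisted section** (G1-END's companion letter `hXφc` for `X(θ·φ) = θ·(c·φ + Xφ)`): continuous `θ`, `φ`, `Xφ` ⇒ continuous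
`h ↦ θ(h)·(c·φ(h) + Xφ(h))`. [cite: KudlaRallis1994, §1] -/
theorem continuous_coe_mul_of_continuous (θ : HA L e dV hdV dW hdW →* ℂˣ) (hθc : Continuous fun p : HA L e dV hdV dW hdW => ((θ p : ℂˣ) : ℂ))
    (c : ℂ) {φ Xφ : HA L e dV hdV dW hdW → ℂ} (hφc : Continuous φ) (hXφc : Continuous Xφ) :
    Continuous fun h : HA L e dV hdV dW hdW => ((θ h : ℂˣ) : ℂ) * (c * φ h + Xφ h) :=
  hθc.mul ((continuous_const.mul hφc).add hXφc)

/-- **the twisted section itself is continuous** (G1-END's `hφc` for `φ_x = θ·φ`). [cite: KudlaRallis1994, §1] -/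
theorem continuous_coe_mul (θ : HA L e dV hdV dW hdW →* ℂˣ) (hθc : Continuous fun p : HA L e dV hdV dW hdW => ((θ p : ℂˣ) : ℂ))
    {φ : HA L e dV hdV dW hdW → ℂ} (hφc : Continuous φ) :
    Continuous fun h : HA L e dV hdV dW hdW => ((θ h : ℂˣ) : ℂ) * φ h :=
  hθc.mul hφc

end ProductRule

/-! ## §2 The character leg: `t ↦ θ(archExp hX t)` is `C^∞` along the letter of a one-place curve (É. Cartan) -/

section CharacterLeg

variable (σ : {v : InfinitePlace (Fp L) // v.IsReal})
  (e₂P : PosIdx (signVec (cmPlaceOver L)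
      (fun k => Sum.elim (cmGramEntry L e dV hdV dW hdW) (-cmGramEntry L e dV hdV dW hdW) ((LocalSplitting.e₂ n).symm k)) (imagUnit L) σ) ≃ Fin 2)
  (e₂Q : NegIdx (signVec (cmPlaceOver L)
      (fun k => Sum.elim (cmGramEntry L e dV hdV dW hdW) (-cmGramEntry L e dV hdV dW hdW) ((LocalSplitting.e₂ n).symm k)) (imagUnit L) σ) ≃ Fin 2)
  (Y : ↥(uFormGroup (Fin 2) (Fin 2)).lie.toSubmodule)
  {X : Matrix (Fin (n + n)) (Fin (n + n)) (mixedSpace L)}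
  (hX : X ∈ archSkew (Fp L) L (IsCMField.complexConj L) (n + n) (hermD L e dV hdV dW hdW))
  (hcurve : ∀ s : ℝ, K2LiuArchOneParameterOrbitDefs.archExp (Fp L) L (IsCMField.complexConj L) (n + n) (hermD L e dV hdV dW hdW) hX s =
        K2LiuArchOneParameterOrbitDefs.archEmb (Fp L) L (IsCMField.complexConj L) (n + n) (hermD L e dV hdV dW hdW)
          (placeSecJ L (IsCMField.complexConj L) (n + n) (IsCMField.complexConj_ne_one L) (cmPlaceOver L) (cmPlaceOver_smul L) _
            (gramD_gram_realDiagonal_entry_ne_zero L e dV hdV dW hdW hdV0 hdW0) (complexConj_imagUnit L) (imagUnit_ne_zero L) σ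
            (cmPlaceOver_comap L) (gramD_eq_diagonal_cm L e dV hdV dW hdW) (J := hermD L e dV hdV dW hdW) rfl
            (complexConj_smul_infinitePlace L) e₂P e₂Q
            ((((uFormGroup (Fin 2) (Fin 2)).expMem
                ⟨((s • Y : ↥(uFormGroup (Fin 2) (Fin 2)).lie.toSubmodule) : Matrix (Fin 2 ⊕ Fin 2) (Fin 2 ⊕ Fin 2) ℂ), (s • Y).2⟩ :
                UForm (Fin 2) (Fin 2)), (1 : UForm Unit Empty)) : Ginf (Fin 2) (Fin 2) Unit Empty)))

include hcurve in
/-- **`t ↦ θ(archExp hX t)` IS `C^∞`** for a continuous character `θ : H(𝔸) →* ℂˣ` along the letter `X` of the one-place curve `s ↦ placeSecJ σ (exp (sY), 1)`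
(`hcurve` = ★ `exists_archSkew_archExp_eq_placeSecJ_expMem`'s identity): the composite `θ ∘ archEmb ∘ placeSecJ σ` is a continuous character of the junction group
`U(2,2) × U(1,0)` (★ `continuous_archEmb`, ★ `continuous_placeSecJ`), hence smooth along `s ↦ exp (sY)` by É. Cartan (★ `K2LiuWeilDatumSmoothU22.contDiffAt_character_inl`,
★ `contDiffAt_coe_expMem_smul`). [cite: Varadarajan1984, Thm. 2.11.2] [cite: BorelJacquet1979, §4.1] -/
theorem contDiffAt_coe_character_archExp (θ : HA L e dV hdV dW hdW →* ℂˣ) (hθc : Continuous fun p : HA L e dV hdV dW hdW => ((θ p : ℂˣ) : ℂ)) (t₀ : ℝ) :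
    ContDiffAt ℝ ((⊤ : ℕ∞) : WithTop ℕ∞)
      (fun t : ℝ => ((θ (K2LiuArchOneParameterOrbitDefs.archExp (Fp L) L (IsCMField.complexConj L) (n + n) (hermD L e dV hdV dW hdW) hX t) : ℂˣ) : ℂ)) t₀ := by
  simp only [hcurve]
  exact K2LiuWeilDatumSmoothU22.contDiffAt_character_inl
    (χ := (Units.coeHom ℂ).comp (θ.comp ((K2LiuArchOneParameterOrbitDefs.archEmb (Fp L) L (IsCMField.complexConj L) (n + n) (hermD L e dV hdV dW hdW)).comp
      (placeSecJ L (IsCMField.complexConj L) (n + n) (IsCMField.complexConj_ne_one L) (cmPlaceOver L) (cmPlaceOver_smul L) _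
            (gramD_gram_realDiagonal_entry_ne_zero L e dV hdV dW hdW hdV0 hdW0) (complexConj_imagUnit L) (imagUnit_ne_zero L) σ
            (cmPlaceOver_comap L) (gramD_eq_diagonal_cm L e dV hdV dW hdW) (J := hermD L e dV hdV dW hdW) rfl
            (complexConj_smul_infinitePlace L) e₂P e₂Q))))
    (hθc.comp ((K2LiuArchOneParameterOrbitDefs.continuous_archEmb (Fp L) L (IsCMField.complexConj L) (n + n) (hermD L e dV hdV dW hdW)).comp
      (continuous_placeSecJ L (IsCMField.complexConj L) (n + n) (IsCMField.complexConj_ne_one L) (cmPlaceOver L) (cmPlaceOver_smul L) _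
            (gramD_gram_realDiagonal_entry_ne_zero L e dV hdV dW hdW hdV0 hdW0) (complexConj_imagUnit L) (imagUnit_ne_zero L) σ
            (cmPlaceOver_comap L) (gramD_eq_diagonal_cm L e dV hdV dW hdW) (J := hermD L e dV hdV dW hdW) rfl
            (complexConj_smul_infinitePlace L) e₂P e₂Q)))
    (contDiffAt_coe_expMem_smul Y t₀)

include hcurve in
/-- **THE CHARACTER LEG**: for a continuous character `θ : H(𝔸) →* ℂˣ` and the letter `X` of the one-place curve of `Y ∈ 𝔲(2,2)` at `σ`,
`HasDerivAt (t ↦ θ(archExp hX t)) (c_X) 0` with `c_X := deriv (t ↦ θ(archExp hX t)) 0` (the one-parameter character is smooth, previous lemma).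
[cite: Varadarajan1984, Thm. 2.11.2] [cite: BorelJacquet1979, §4.1] -/
theorem hasDerivAt_coe_character_archExp (θ : HA L e dV hdV dW hdW →* ℂˣ) (hθc : Continuous fun p : HA L e dV hdV dW hdW => ((θ p : ℂˣ) : ℂ)) :
    HasDerivAt (fun t : ℝ => ((θ (K2LiuArchOneParameterOrbitDefs.archExp (Fp L) L (IsCMField.complexConj L) (n + n) (hermD L e dV hdV dW hdW) hX t) : ℂˣ) : ℂ))
      (deriv (fun t : ℝ => ((θ (K2LiuArchOneParameterOrbitDefs.archExp (Fp L) L (IsCMField.complexConj L) (n + n) (hermD L e dV hdV dW hdW) hX t) : ℂˣ) : ℂ)) 0) 0 :=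
  ((contDiffAt_coe_character_archExp L e dV hdV hdV0 dW hdW hdW0 σ e₂P e₂Q Y hX hcurve θ hθc 0).differentiableAt (by simp)).hasDerivAt

include hcurve in
/-- **CM twin: the determinant twist `θ = detChar α = α ∘ det`** (★ `DoubledWeilDetTwist.detChar`, continuous for continuous `α` by ★ `continuous_coe_detChar`):
`HasDerivAt (t ↦ detChar α (archExp hX t)) (c_X) 0`, `c_X := deriv (t ↦ detChar α (archExp hX t)) 0`. [cite: GelbartRogawski1991, §3.1 Remark p. 457] [cite: Varadarajan1984, Thm. 2.11.2] -/
theorem hasDerivAt_coe_detChar_archExp (α : UnitaryGroup.adelicOne (Fp L) L (IsCMField.complexConj L) →* ℂˣ) (hα : Continuous α) :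
    HasDerivAt (fun t : ℝ => ((DoubledWeilDetTwist.detChar L e dV hdV hdV0 dW hdW hdW0 α
        (K2LiuArchOneParameterOrbitDefs.archExp (Fp L) L (IsCMField.complexConj L) (n + n) (hermD L e dV hdV dW hdW) hX t) : ℂˣ) : ℂ))
      (deriv (fun t : ℝ => ((DoubledWeilDetTwist.detChar L e dV hdV hdV0 dW hdW hdW0 α
        (K2LiuArchOneParameterOrbitDefs.archExp (Fp L) L (IsCMField.complexConj L) (n + n) (hermD L e dV hdV dW hdW) hX t) : ℂˣ) : ℂ)) 0) 0 :=
  hasDerivAt_coe_character_archExp L e dV hdV hdV0 dW hdW hdW0 σ e₂P e₂Q Y hX hcurve _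
    (DoubledWeilDetTwist.continuous_coe_detChar L e dV hdV hdV0 dW hdW hdW0 α hα)

/-! ## §3 The producer for #42F′'s generator: `X(detChar α · φ) = detChar α · (c_X · φ + Xφ)` -/

include hcurve in
/-- **THE PRODUCER `Xφ` FOR THE CHARACTER-TWISTED GENERATOR (F2 of the FACE-G organ plan).**  For a continuous `α` (twist `detChar α = α ∘ det`), the letter `X` of the
one-place curve of `Y ∈ 𝔲(2,2)` at `σ` (`hcurve`), and a section `φ` with right Lie derivative `Xφ` along `γ_X` BY VALUE (`hXφ` — for `φ = swSectionTensor sB (E(a ⊗ f))`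
on polynomial × Gaussian data it is ★ (r-b) `exists_fockPoly_hasDerivAt_swSectionTensor_oneplace` read through the curve identity, with `Xφ = swSectionTensor sB (E(a_Y ⊗ f))`):
for EVERY `h ∈ H(𝔸)`, **`HasDerivAt (t ↦ detChar α (h·γ_X t) · φ(h·γ_X t)) (detChar α h · (c_X · φ h + Xφ h)) 0`**, `c_X := deriv (t ↦ detChar α (γ_X t)) 0` — G1-END's
`hXφ` for `φ_x := detChar α · φ` with `X φ_x = detChar α · (c_X·φ + Xφ)` (for SW data `= φ_{x′}`, `x′ = E((c_X • a + a_Y) ⊗ f)` by ★ `swSectionTensor_add`∕`_smul`).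
[cite: KudlaRallis1994, §1] [cite: Varadarajan1984, Thm. 2.10.1, Thm. 2.11.2] [cite: GelbartRogawski1991, §3.1 Remark p. 457] -/
theorem hasDerivAt_detChar_mul_archExp (α : UnitaryGroup.adelicOne (Fp L) L (IsCMField.complexConj L) →* ℂˣ) (hα : Continuous α)
    {φ Xφ : HA L e dV hdV dW hdW → ℂ}
    (hXφ : ∀ h : HA L e dV hdV dW hdW,
      HasDerivAt (fun t : ℝ => φ (h * K2LiuArchOneParameterOrbitDefs.archExp (Fp L) L (IsCMField.complexConj L) (n + n) (hermD L e dV hdV dW hdW) hX t)) (Xφ h) 0)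
    (h : HA L e dV hdV dW hdW) :
    HasDerivAt (fun t : ℝ =>
        ((DoubledWeilDetTwist.detChar L e dV hdV hdV0 dW hdW hdW0 α
            (h * K2LiuArchOneParameterOrbitDefs.archExp (Fp L) L (IsCMField.complexConj L) (n + n) (hermD L e dV hdV dW hdW) hX t) : ℂˣ) : ℂ) *
          φ (h * K2LiuArchOneParameterOrbitDefs.archExp (Fp L) L (IsCMField.complexConj L) (n + n) (hermD L e dV hdV dW hdW) hX t))
      (((DoubledWeilDetTwist.detChar L e dV hdV hdV0 dW hdW hdW0 α h : ℂˣ) : ℂ) *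
        (deriv (fun t : ℝ => ((DoubledWeilDetTwist.detChar L e dV hdV hdV0 dW hdW hdW0 α
            (K2LiuArchOneParameterOrbitDefs.archExp (Fp L) L (IsCMField.complexConj L) (n + n) (hermD L e dV hdV dW hdW) hX t) : ℂˣ) : ℂ)) 0 * φ h + Xφ h)) 0 :=
  hasDerivAt_coe_mul_archExp_of_hasDerivAt L e dV hdV dW hdW hX _ (hasDerivAt_coe_detChar_archExp L e dV hdV hdV0 dW hdW hdW0 σ e₂P e₂Q Y hX hcurve α hα) hXφ h

end CharacterLeg

end Summit.HodgeConjecture.HodgeConjecture.Cruxes.HLiu418.K2LiuSwSectionTensorArchOrbitDeriv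

end
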